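import Summits.BirchSwinnertonDyer.Rank1Residual.GaloisImage.KolyvaginSystemsKummerVanish
import Summits.BirchSwinnertonDyer.Rank1Residual.GaloisImage.KolyvaginPrimeLocalShapeRatHolds
import Literature.NumberTheory.EllipticCurves.SelmerFiniteProofs
import HarnessLib

/-!
# `KS₁(E[p], 𝓚, 𝒫(τ)) = 0` over `ℚ` with the Kolyvagin-prime local shape DISCHARGED: the
# ℚ-instance of the core-rank-zero vanishing theorem for the classical Selmer structure
# (cell `b2b-bsdres`, team n1011, ROUTE-1 item R1-16, file 6 — lead ruling PLAN.md R5-40 (c);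
# seat p11; skeleton `cells/n1011/skel/T-R1-16.md`)

HONEST FRAMING (verbatim for the cell): research route; prove what is provable now; shrink each hard
class to its core with data; no claim beyond stated classes; nothing booked; no mark / label moved.
ONE theorem, no definition, no named fact, no conjecture node.

For an elliptic curve `E/ℚ`, an odd prime `p`, and a Kolyvagin datum `D` on `E[p]` whose primes are
Sakamoto's `τ`-class primes `𝒫(τ) = frobeniusClassPrimes ρ S τ p` (`τ ∈ Γ_{ℚ(μ_p)}` with
`E[p]/(τ − 1)E[p] ≅ ℤ/p`, the (H.2) datum) and whose transverse conditions are the cyclotomic ones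
(`cyclotomicTransverse`), the three local-shape binders of `kummer_kolyvaginSystems_eq_bot`
(file 5) are THEOREMS of the cell's row T-R1-16-LOC (n1011-p18):
`#H¹_ur(ℚ_𝔮, E[p]) = p` (`natCard_unramifiedSubgroup_toLocal_of_primes_eq`, Rubin PCMI Prop. 1.4.13
(1)), `#H¹_tr(ℚ_𝔮, E[p]) = p` and `H¹ = H¹_ur + H¹_tr` (the unconditional ℚ-readings
`natCard_transverse_rat_of_primes_eq_of_smul_eq_zero'`,
`unramifiedSubgroup_sup_transverse_eq_top_rat_of_primes_eq_of_smul_eq_zero'`, Rubin Prop. 1.9.5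
(1)/(3), through Serre, *Local Fields* IV §4 Prop. 17–18 proved in the tree by n1011-lit's
`Rat.exists_mem_absInertia_adicCompletion_modPCyclotomicCharacterZMod_eq_of_absNorm_eq`); the
finiteness of `Sel^{(p)}(E/ℚ) = H¹_𝓚(ℚ, E[p])` is Silverman X.4.2 (b) (`finite_selmerGroup_holds`
through `selmerGroup_eq_selmerGroup_kummerSelmerStructure`); and `𝒫(τ) ∩ S = ∅` is part of the
definition of `frobeniusClassPrimes`.  What REMAINS as binders: the Poitou–Tate family
(`IsPerfect`, `SumLocalTermEqZero`, `SelmerComplement` — the cited fact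
`poitouTate_selmerStructure_duality`), Tate's local Euler characteristic `hEP` (cited fact
`localEulerPoincareCharacteristic`), the finite set `S ⊇ ∞ ∪ {p} ∪ Ram(E[p])` with `𝓚` unramified
outside `S` (X11b `KummerDuality.kummerSelmerStructure_isUnramifiedOutside` at the consumer's
spelling of the level), the admissibility of the comparison maps `hadm` (row T-HCC-adm, n1011-p04)
and the prime choice `hC55` — Sakamoto, JTNB 36 (2024) Cor. 5.5 (typer backlog TB-S24C55; the
Chebotarev density theorem is not in the tree).

References: [Rubin2011] Prop. 1.4.13, Prop. 1.9.5, Thm. 2.7.6; [Sakamoto2024] §2 (`𝒫`), Def. 3.6,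
Cor. 5.5 (p. 929); [SilvermanAEC2009] Thm. X.4.2 (b), Prop. III.8.1; [SerreLocalFields1979] IV §4
Prop. 17–18.
-/

noncomputable section

open scoped Classical NumberField ContRepresentation
open Function Field NumberField IsDedekindDomain WeierstrassCurve
open Literature.NumberTheory.EllipticCurves
open Literature.NumberTheory.GaloisRepresentations Literature.NumberTheory.GaloisRepresentations.DiscreteGaloisModule
  Literature.NumberTheory.GaloisCohomology

namespace Summit.BirchSwinnertonDyer.Rank1Residual.GaloisImage.CoreRankZero

/-- **`KS₁(E[p], 𝓚, 𝒫(τ)) = 0` over `ℚ`, local shape discharged.**  `E/ℚ` elliptic, `p` an odd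
prime, `𝓚 = kummerSelmerStructure p` the classical `p`-descent structure, `D` a Kolyvagin datum on
`E[p]` with `D.primes = frobeniusClassPrimes ρ {v | v ∈ S} τ p` (`τ ∈ Γ_{ℚ(μ_p)}`,
`E[p]/(τ−1)E[p] ≅ ℤ/p`) and `D.transverse = cyclotomicTransverse ρ`: then every Kolyvagin system for
`(E[p], 𝓚, 𝒫(τ))` vanishes — from file 5 (`kummer_kolyvaginSystems_eq_bot`: `χ(𝓚) = 0` by the
Weil self-duality count, then Rubin PCMI Thm. 2.7.6 at `m = 1`), with `hU`/`hT`/`hUT` supplied by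
n1011-p18's T-R1-16-LOC theorems, `Finite Sel^{(p)}(E/ℚ)` by Silverman X.4.2 (b), and `𝒫(τ) ∩ S = ∅`
by the definition of `frobeniusClassPrimes`.  Binders kept (all named): Poitou–Tate family, `hEP`,
`hS`/`h𝓚` (the finite set `S`), `hadm` (T-HCC-adm), `hC55` ([S24] Cor. 5.5 shape, TB-S24C55).
[cite: Rubin2011, Thm. 2.7.6 (p. 24), Prop. 1.9.5 (p. 16)] [cite: Sakamoto2024, §2 (p. 921) and Cor. 5.5 (p. 929)]
[cite: SilvermanAEC2009, Thm X.4.2(b)] -/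
theorem kummer_kolyvaginSystems_eq_bot_rat (W : WeierstrassCurve ℚ) [W.IsElliptic]
    (p : ℕ) [Fact p.Prime] (hp2 : p ≠ 2) [Finite (geomTorsion W (p : ℤ))]
    {inv : LocalInvariants ℚ p}
    (hperf : inv.IsPerfect) (hsum : inv.SumLocalTermEqZero) (hcompl : inv.SelmerComplement)
    (hEP : ∀ v : HeightOneSpectrum (𝓞 ℚ), localEulerPoincareCharacteristic (v.adicCompletion ℚ))
    {S : Finset (Place ℚ)}
    (hS : ∀ v : HeightOneSpectrum (𝓞 ℚ), (Sum.inr v : Place ℚ) ∉ S →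
      ((p : ℕ) : 𝓞 ℚ) ∉ v.asIdeal ∧ GaloisRep.IsUnramifiedAt v (W.torsionGaloisModule (p : ℤ)))
    (h𝓚 : (W.kummerSelmerStructure (p : ℤ)).IsUnramifiedOutside S)
    {D : KolyvaginDatum (W.torsionGaloisModule (p : ℤ))} {τ : absoluteGaloisGroup ℚ}
    (hP : D.primes = frobeniusClassPrimes (W.torsionGaloisModule (p : ℤ))
      {v | (Sum.inr v : Place ℚ) ∈ S} τ p)
    (hT : D.transverse = cyclotomicTransverse (W.torsionGaloisModule (p : ℤ)))
    (hτ : Nonempty (cokerSubOne (W.torsionGaloisModule (p : ℤ)) τ ≃+ ZMod p))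
    (hτμ : τ ∈ rootsOfUnityFixer ℚ p)
    (hadm : D.IsAdmissible)
    (hC55 : ∀ c₁ c₂ c₃ : galoisCohomology (W.torsionGaloisModule (p : ℤ)) 1, c₁ ≠ 0 → c₂ ≠ 0 →
      c₃ ≠ 0 →
      {q ∈ D.primes |
        galoisCohomology.localization (W.torsionGaloisModule (p : ℤ)) (Sum.inr q) 1 c₁ ≠ 0 ∧
        galoisCohomology.localization (W.torsionGaloisModule (p : ℤ)) (Sum.inr q) 1 c₂ ≠ 0 ∧
        galoisCohomology.localization (W.torsionGaloisModule (p : ℤ)) (Sum.inr q) 1 c₃ ≠ 0}.Infinite) :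
    D.kolyvaginSystems (W.kummerSelmerStructure (p : ℤ)) = ⊥ := by
  have hp : p.Prime := Fact.out
  haveI : NeZero p := ⟨hp.ne_zero⟩
  -- `Sel^{(p)}(E/ℚ)` is finite (Silverman X.4.2 (b))
  haveI : Finite (W.kummerSelmerStructure (p : ℤ)).selmerGroup := by
    rw [← selmerGroup_eq_selmerGroup_kummerSelmerStructure]
    exact W.finite_selmerGroup_holds (by exact_mod_cast hp.ne_zero)
  -- `E[p]` is killed by `p`
  have hMN : ∀ m : geomTorsion W (p : ℤ), p • m = 0 := fun T => AddSubgroup.torsionBy.nsmul T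
  -- the primes of `𝒫(τ)` lie outside `S` (definition of `frobeniusClassPrimes`)
  have hPS : ∀ q ∈ D.primes, (Sum.inr q : Place ℚ) ∉ S := by
    intro q hq
    rw [hP] at hq
    exact hq.1
  -- the local shape (row T-R1-16-LOC, n1011-p18)
  have hU := natCard_unramifiedSubgroup_toLocal_of_primes_eq (W.torsionGaloisModule (p : ℤ)) hP hτ
  have hT' := natCard_transverse_rat_of_primes_eq_of_smul_eq_zero' (W.torsionGaloisModule (p : ℤ))
    hP hT hτ hτμ hMN
  have hUT := unramifiedSubgroup_sup_transverse_eq_top_rat_of_primes_eq_of_smul_eq_zero'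
    (W.torsionGaloisModule (p : ℤ)) hP hT hτμ hMN
  exact kummer_kolyvaginSystems_eq_bot W p hp2 hperf hsum hcompl hEP hS h𝓚 hPS hadm hU hT' hUT hC55

end Summit.BirchSwinnertonDyer.Rank1Residual.GaloisImage.CoreRankZero

end
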